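import Mathlib
import Literature.Probability.LatticeModels.ConformalCovariance
import Summits.CriticalPhenomena.Ising3DConformalLimit.Theorems.PrecisionLaplacianMoebiusLimitOfTwoPointLawInversionBegetsRotations
import HarnessLib

/-!
# The unit inversion as a threefold reflect-invert: `stub_inversionOfReflectInvert`

(Registered stub `stub_inversionOfReflectInvert` of line `multipole-ward-nonsat-endpoint` for the
crux `MoebiusLimitOfTwoPointLaw`, item stmt-CriticalPhenomena-4801; a `--supports` helper.)

For a unit vector `u` of `ℝ³` write `R_u y = y − 2⟪u, y⟫ u` for the reflection in the plane
`u^⊥` and `J_u y = R_u y / ‖y‖²` for the "reflect-invert" (`= ι ∘ R_u = R_u ∘ ι`, `ι y = y/‖y‖²`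
the unit inversion). The stub: if `S : CorrFamily 3` is parity-even
(`S n (−x) = S n x`) and satisfies `S n (J_u ∘ y) = (∏ᵢ (‖yᵢ‖²)^Δ) · S n y` for every unit `u`
and every configuration `y` avoiding the point `u` and the closed ray `{−μ u : μ ≥ 0}`, then
`S` is inversion covariant with weight `Δ` (`IsInversionCovariant Δ S`).

Proof. For an orthonormal frame `{b, w, w'}` of `ℝ³`, `R_w ∘ R_{w'} = −R_b`
(`rinv_reflect_reflect_frame`), whence `J_b ∘ J_w ∘ J_{w'} ∘ (−1) = ι` pointwise
(`rinv_stage2_reflectInvert`, `rinv_stage3_reflectInvert`), and the three weights multiply to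
`∏ᵢ ‖xᵢ‖^{2Δ}`. The frame is chosen generically (`rinv_exists_unit`, `rinv_exists_frame`):
`⟪b, xᵢ⟫ ≠ 0` and `xᵢ ∉ ℝ b` for all `i`, which keeps the three intermediate configurations off
the forbidden point and ray (`rinv_ne_of_inner`, `rinv_reflect_ne`).

References: P. Di Francesco, P. Mathieu, D. Sénéchal, *Conformal Field Theory* (Springer 1997),
§4.1 (the conformal group of `ℝ^d` is generated by similarities and the unit inversion). Pure
linear algebra; nothing here is specific to the Ising model.
-/

noncomputable section

open Literature.Probability.LatticeModels EuclideanGeometry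

namespace Summit.CriticalPhenomena.Ising3DConformalLimit.PrecisionLaplacianMoebiusLimitOfTwoPointLaw

/-- The reflection `R_u y = y − 2⟪u, y⟫ u` in the plane orthogonal to a unit vector `u` preserves
norms. [folklore] -/
theorem rinv_norm_reflect {u : EuclideanSpace ℝ (Fin 3)} (hu : ‖u‖ = 1)
    (y : EuclideanSpace ℝ (Fin 3)) : ‖y - (2 * inner ℝ u y) • u‖ = ‖y‖ := by
  have h : ‖y - (2 * inner ℝ u y) • u‖ ^ 2 = ‖y‖ ^ 2 := by
    rw [norm_sub_sq_real, norm_smul, real_inner_smul_right, hu, mul_one, Real.norm_eq_abs,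
      sq_abs, real_inner_comm u y]
    ring
  exact (pow_left_inj₀ (norm_nonneg _) (norm_nonneg _) two_ne_zero).1 h

/-- `R_u` is an involution for a unit vector `u`. [folklore] -/
theorem rinv_reflect_reflect {u : EuclideanSpace ℝ (Fin 3)} (hu : ‖u‖ = 1)
    (y : EuclideanSpace ℝ (Fin 3)) :
    (y - (2 * inner ℝ u y) • u) - (2 * inner ℝ u (y - (2 * inner ℝ u y) • u)) • u = y := by
  rw [inner_sub_right, real_inner_smul_right, real_inner_self_eq_norm_sq, hu, one_pow, mul_one]
  module

/-- `R_u` commutes with scalar multiplication. [folklore] -/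
theorem rinv_reflect_smul (u : EuclideanSpace ℝ (Fin 3)) (c : ℝ) (y : EuclideanSpace ℝ (Fin 3)) :
    c • y - (2 * inner ℝ u (c • y)) • u = c • (y - (2 * inner ℝ u y) • u) := by
  rw [real_inner_smul_right]
  module

/-- `R_u` commutes with negation. [folklore] -/
theorem rinv_reflect_neg (u y : EuclideanSpace ℝ (Fin 3)) :
    -y - (2 * inner ℝ u (-y)) • u = -(y - (2 * inner ℝ u y) • u) := by
  rw [inner_neg_right]
  module

/-- `⟪b, R_u y⟫ = ⟪b, y⟫` when `b ⊥ u`. [folklore] -/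
theorem rinv_inner_reflect {b u : EuclideanSpace ℝ (Fin 3)} (hbu : inner ℝ b u = 0)
    (y : EuclideanSpace ℝ (Fin 3)) : inner ℝ b (y - (2 * inner ℝ u y) • u) = inner ℝ b y := by
  rw [inner_sub_right, real_inner_smul_right, hbu, mul_zero, sub_zero]

/-- Frame identity: for `w ⊥ w'` and `y` expanded in the frame `{b, w, w'}`,
`R_w (R_{w'} y) = −R_b y`. [folklore] -/
theorem rinv_reflect_reflect_frame {b w w' y : EuclideanSpace ℝ (Fin 3)} (hww' : inner ℝ w w' = 0)
    (hexp : inner ℝ b y • b + inner ℝ w y • w + inner ℝ w' y • w' = y) :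
    (y - (2 * inner ℝ w' y) • w') - (2 * inner ℝ w (y - (2 * inner ℝ w' y) • w')) • w
      = -(y - (2 * inner ℝ b y) • b) := by
  rw [inner_sub_right, real_inner_smul_right, hww', mul_zero, sub_zero]
  have h2 : (2 * inner ℝ b y) • b = (2 : ℝ) • (inner ℝ b y • b + inner ℝ w y • w
      + inner ℝ w' y • w') - (2 * inner ℝ w y) • w - (2 * inner ℝ w' y) • w' := by
    module
  rw [hexp] at h2
  rw [h2]
  module

/-- If `x` is not parallel to `b` then `R_b x` avoids the point `b` and the ray `{−μ b : μ ≥ 0}`.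
[folklore] -/
theorem rinv_reflect_ne {b x : EuclideanSpace ℝ (Fin 3)} (hxb : ∀ μ : ℝ, x ≠ μ • b) :
    x - (2 * inner ℝ b x) • b ≠ b ∧ ∀ μ : ℝ, 0 ≤ μ → x - (2 * inner ℝ b x) • b ≠ -(μ • b) := by
  constructor
  · intro h
    exact hxb (1 + 2 * inner ℝ b x) (by rw [add_smul, one_smul]; exact sub_eq_iff_eq_add.1 h)
  · intro μ _ h
    exact hxb (2 * inner ℝ b x - μ)
      (by rw [sub_smul, ← neg_add_eq_sub]; exact sub_eq_iff_eq_add.1 h)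

/-- If `⟪b, y⟫ ≠ 0` and `b ⊥ u` then `y` avoids the point `u` and the ray `{−μ u : μ ≥ 0}`.
[folklore] -/
theorem rinv_ne_of_inner {b u y : EuclideanSpace ℝ (Fin 3)} (hbu : inner ℝ b u = 0)
    (hby : inner ℝ b y ≠ 0) : y ≠ u ∧ ∀ μ : ℝ, 0 ≤ μ → y ≠ -(μ • u) := by
  constructor
  · rintro rfl
    exact hby hbu
  · rintro μ - rfl
    apply hby
    rw [inner_neg_right, real_inner_smul_right, hbu, mul_zero, neg_zero]

/-- Generic direction: for finitely many nonzero `x i ∈ ℝ³` there is a unit vector `b` orthogonal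
to none of them and parallel to none of them. [folklore] -/
theorem rinv_exists_unit {n : ℕ} (x : Fin n → EuclideanSpace ℝ (Fin 3)) (hx0 : ∀ i, x i ≠ 0) :
    ∃ b : EuclideanSpace ℝ (Fin 3), ‖b‖ = 1 ∧
      ∀ i, inner ℝ b (x i) ≠ 0 ∧ ∀ μ : ℝ, x i ≠ μ • b := by
  obtain ⟨t, ht⟩ := Infinite.exists_notMem_finset
    (Finset.univ.image (fun i => -(x i 2) / x i 0) ∪ Finset.univ.image (fun i => x i 0 / x i 2))
  obtain ⟨s, hs⟩ := Infinite.exists_notMem_finset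
    (Finset.univ.image (fun i => -(x i 2 + t * x i 0) / x i 1))
  simp only [Finset.mem_union, Finset.mem_image, Finset.mem_univ, true_and, not_or,
    not_exists] at ht hs
  set b₀ : EuclideanSpace ℝ (Fin 3) := !₂[t, s, 1] with hb₀
  have hb0 : b₀ 0 = t := by simp [hb₀]
  have hb1 : b₀ 1 = s := by simp [hb₀]
  have hb2 : b₀ 2 = 1 := by simp [hb₀]
  have hinner : ∀ i, inner ℝ b₀ (x i) = t * x i 0 + s * x i 1 + x i 2 := by
    intro i
    rw [PiLp.inner_apply, Fin.sum_univ_three]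
    simp only [RCLike.inner_apply, conj_trivial, hb0, hb1, hb2]
    ring
  have hne0 : b₀ ≠ 0 := fun h => by
    have h' := congrArg (· 2) h
    simp [hb2] at h'
  have hnorm : ‖b₀‖ ≠ 0 := norm_ne_zero_iff.2 hne0
  refine ⟨‖b₀‖⁻¹ • b₀, by rw [norm_smul, norm_inv, norm_norm, inv_mul_cancel₀ hnorm],
    fun i => ⟨?_, ?_⟩⟩
  · rw [real_inner_smul_left, hinner]
    refine mul_ne_zero (inv_ne_zero hnorm) ?_
    intro h
    by_cases hβ : x i 1 = 0
    · by_cases hα : x i 0 = 0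
      · rw [hα, hβ, mul_zero, mul_zero, zero_add, zero_add] at h
        apply hx0 i
        ext j
        fin_cases j <;> simp [hα, hβ, h]
      · apply ht.1 i
        rw [hβ, mul_zero, add_zero] at h
        field_simp
        linarith
    · apply hs i
      field_simp
      linarith
  · intro μ h
    have h2 : x i 2 = μ * ‖b₀‖⁻¹ := by
      have h' := congrArg (· 2) h
      simpa [hb2] using h'
    have h0 : x i 0 = μ * ‖b₀‖⁻¹ * t := by
      have h' := congrArg (· 0) h
      simpa [hb0, mul_assoc] using h'
    by_cases hγ : x i 2 = 0
    · apply hx0 i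
      rw [h, smul_smul, ← h2, hγ, zero_smul]
    · have hμ : μ ≠ 0 := by
        rintro rfl
        exact hγ (by rw [h2, zero_mul])
      apply ht.2 i
      rw [h0, h2]
      field_simp

/-! ### An orthonormal frame through `b` -/

/-- Every unit vector `b` of `ℝ³` is the first vector of an orthonormal frame `{b, w, w'}`, in
which every vector expands as `y = ⟪b, y⟫ b + ⟪w, y⟫ w + ⟪w', y⟫ w'`. [folklore] -/
theorem rinv_exists_frame {b : EuclideanSpace ℝ (Fin 3)} (hb : ‖b‖ = 1) :
    ∃ w w' : EuclideanSpace ℝ (Fin 3), ‖w‖ = 1 ∧ ‖w'‖ = 1 ∧ inner ℝ b w = 0 ∧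
      inner ℝ b w' = 0 ∧ inner ℝ w w' = 0 ∧ ∀ y : EuclideanSpace ℝ (Fin 3),
        inner ℝ b y • b + inner ℝ w y • w + inner ℝ w' y • w' = y := by
  have hon : Orthonormal ℝ (({0} : Set (Fin 3)).restrict fun _ : Fin 3 => b) := by
    rw [orthonormal_subsingleton_iff]
    intro i
    exact hb
  obtain ⟨v, hv⟩ := hon.exists_orthonormalBasis_extension_of_card_eq
    (by simp [finrank_euclideanSpace])
  have hv0 : v 0 = b := hv 0 (Set.mem_singleton 0)
  refine ⟨v 1, v 2, v.norm_eq_one 1, v.norm_eq_one 2, ?_, ?_, v.inner_eq_zero (by decide),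
    fun y => ?_⟩
  · rw [← hv0]
    exact v.inner_eq_zero (by decide)
  · rw [← hv0]
    exact v.inner_eq_zero (by decide)
  · have h := v.sum_repr' y
    rw [Fin.sum_univ_three, hv0] at h
    exact h

/-! ### The chain `J_b ∘ J_w ∘ J_{w'} ∘ (−1) = ι`, pointwise -/

/-- Stage two, rewritten: `J_{w'}(−x) = −‖x‖⁻² R_{w'} x`. [folklore] -/
theorem rinv_stage2_eq (w' x : EuclideanSpace ℝ (Fin 3)) :
    (‖-x‖ ^ 2)⁻¹ • (-x - (2 * inner ℝ w' (-x)) • w') =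
      -((‖x‖ ^ 2)⁻¹ • (x - (2 * inner ℝ w' x) • w')) := by
  rw [norm_neg, rinv_reflect_neg, smul_neg]

/-- Stage two has norm `‖J_{w'}(−x)‖² = ‖x‖⁻²`. [folklore] -/
theorem rinv_stage2_norm_sq {w' : EuclideanSpace ℝ (Fin 3)} (hw' : ‖w'‖ = 1)
    (x : EuclideanSpace ℝ (Fin 3)) :
    ‖(‖-x‖ ^ 2)⁻¹ • (-x - (2 * inner ℝ w' (-x)) • w')‖ ^ 2 = (‖x‖ ^ 2)⁻¹ := by
  rw [norm_smul, rinv_norm_reflect hw', norm_neg, norm_inv, norm_pow, norm_norm]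
  by_cases hx : ‖x‖ = 0
  · rw [hx]
    simp
  · field_simp

/-- Stage two is not orthogonal to `b` when `x` is not (`b ⊥ w'`):
`⟪b, J_{w'}(−x)⟫ = −‖x‖⁻² ⟪b, x⟫`. [folklore] -/
theorem rinv_stage2_inner {b w' : EuclideanSpace ℝ (Fin 3)} (hbw' : inner ℝ b w' = 0)
    (x : EuclideanSpace ℝ (Fin 3)) :
    inner ℝ b ((‖-x‖ ^ 2)⁻¹ • (-x - (2 * inner ℝ w' (-x)) • w')) =
      -((‖x‖ ^ 2)⁻¹ * inner ℝ b x) := by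
  rw [real_inner_smul_right, rinv_inner_reflect hbw', inner_neg_right, norm_neg, mul_neg]

/-- **Key algebra**: `J_w (J_{w'} (−x)) = R_b x` for `x ≠ 0` in an orthonormal frame
`{b, w, w'}`. [folklore] -/
theorem rinv_stage2_reflectInvert {b w w' x : EuclideanSpace ℝ (Fin 3)} (hx : x ≠ 0)
    (hw' : ‖w'‖ = 1) (hww' : inner ℝ w w' = 0)
    (hexp : inner ℝ b x • b + inner ℝ w x • w + inner ℝ w' x • w' = x)
    (z : EuclideanSpace ℝ (Fin 3)) (hz : z = (‖-x‖ ^ 2)⁻¹ • (-x - (2 * inner ℝ w' (-x)) • w')) :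
    (‖z‖ ^ 2)⁻¹ • (z - (2 * inner ℝ w z) • w) = x - (2 * inner ℝ b x) • b := by
  have hx2 : ‖x‖ ^ 2 ≠ 0 := pow_ne_zero 2 (norm_ne_zero_iff.2 hx)
  subst hz
  rw [rinv_stage2_norm_sq hw', inv_inv, rinv_stage2_eq,
    rinv_reflect_neg w ((‖x‖ ^ 2)⁻¹ • (x - (2 * inner ℝ w' x) • w')), rinv_reflect_smul,
    smul_neg, smul_smul, mul_inv_cancel₀ hx2, one_smul, rinv_reflect_reflect_frame hww' hexp,
    neg_neg]

/-- Stage three: `J_b (R_b x) = ι x`, the last reflect-invert lands on the unit inversion.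
[folklore] -/
theorem rinv_stage3_reflectInvert {b : EuclideanSpace ℝ (Fin 3)} (hb : ‖b‖ = 1)
    (x z : EuclideanSpace ℝ (Fin 3)) (hz : z = x - (2 * inner ℝ b x) • b) :
    (‖z‖ ^ 2)⁻¹ • (z - (2 * inner ℝ b z) • b) = inversion 0 1 x := by
  subst hz
  rw [rinv_reflect_reflect hb, rinv_norm_reflect hb, inversion_zero_one_eq_smul]

/-! ### The registered stub -/

/-- **Stub `stub_inversionOfReflectInvert`** (line `multipole-ward-nonsat-endpoint` of the crux
`MoebiusLimitOfTwoPointLaw`, item stmt-CriticalPhenomena-4801). If a parity-even family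
`S : CorrFamily 3` is covariant with weight `∏ (‖yᵢ‖²)^Δ` under every "reflect-invert"
`J_u y = (y − 2⟪u, y⟫ u)/‖y‖²` (`u` a unit vector) at configurations avoiding the point `u` and the
ray `{−μ u : μ ≥ 0}`, then it is covariant under the unit inversion `ι y = y/‖y‖²` with weight
`∏ ‖xᵢ‖^{2Δ}` (`IsInversionCovariant Δ S`). Proof: for an orthonormal frame `{b, w, w'}` one has
`J_b ∘ J_w ∘ J_{w'} = ι ∘ (−1)` with total weight `∏ ‖xᵢ‖^{2Δ}`, and parity removes the `−1`;
the frame is chosen with `⟪b, xᵢ⟫ ≠ 0` and `xᵢ ∉ ℝ b` for all `i`, which makes the three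
applications legal. (Di Francesco–Mathieu–Sénéchal 1997, §4.1.) [folklore] -/
theorem stub_inversionOfReflectInvert :
    ∀ (S : CorrFamily 3) (Δ : ℝ), (∀ n z, z ∉ NonCoincident 3 n → S n z = 0) →
      (∀ n (x : Fin n → EuclideanSpace ℝ (Fin 3)), S n (fun i => -(x i)) = S n x) →
      (∀ (n : ℕ) (b : EuclideanSpace ℝ (Fin 3)), ‖b‖ = 1 → ∀ (y : Fin n → EuclideanSpace ℝ (Fin 3)),
        (∀ i, y i ≠ b) → (∀ i (μ : ℝ), 0 ≤ μ → y i ≠ -(μ • b)) →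
        S n (fun i => (‖y i‖ ^ 2)⁻¹ • (y i - (2 * inner ℝ b (y i)) • b)) = (∏ i, (‖y i‖ ^ 2) ^ Δ) * S n y) →
      IsInversionCovariant Δ S := by
  intro S Δ _ hpar hJ n x hx0
  obtain ⟨b, hb, hbx⟩ := rinv_exists_unit x hx0
  obtain ⟨w, w', hw, hw', hbw, hbw', hww', hexp⟩ := rinv_exists_frame hb
  set z₂ : Fin n → EuclideanSpace ℝ (Fin 3) :=
    fun i => (‖-x i‖ ^ 2)⁻¹ • (-x i - (2 * inner ℝ w' (-x i)) • w')
  set z₁ : Fin n → EuclideanSpace ℝ (Fin 3) := fun i => x i - (2 * inner ℝ b (x i)) • b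
  -- Stage 1: `J_{w'}` at `−x`, then parity.
  have h1 : S n z₂ = (∏ i, (‖-x i‖ ^ 2) ^ Δ) * S n x := by
    have hl := fun i => rinv_ne_of_inner hbw' (y := -x i)
      (by rw [inner_neg_right, neg_ne_zero]; exact (hbx i).1)
    rw [← hpar n x]
    exact hJ n w' hw' (fun i => -x i) (fun i => (hl i).1) (fun i => (hl i).2)
  -- Stage 2: `J_w` at `z₂`, landing on `z₁ = R_b x` by the key algebra.
  have h2 : S n z₁ = (∏ i, (‖z₂ i‖ ^ 2) ^ Δ) * S n z₂ := by
    have hl := fun i => rinv_ne_of_inner hbw (y := z₂ i) (by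
      rw [rinv_stage2_inner hbw' (x i)]
      exact neg_ne_zero.2 (mul_ne_zero
        (inv_ne_zero (pow_ne_zero 2 (norm_ne_zero_iff.2 (hx0 i)))) (hbx i).1))
    have hcfg : (fun i => (‖z₂ i‖ ^ 2)⁻¹ • (z₂ i - (2 * inner ℝ w (z₂ i)) • w)) = z₁ :=
      funext fun i => rinv_stage2_reflectInvert (hx0 i) hw' hww' (hexp (x i)) (z₂ i) rfl
    rw [← hcfg]
    exact hJ n w hw z₂ (fun i => (hl i).1) (fun i => (hl i).2)
  -- Stage 3: `J_b` at `z₁`, landing on `ι x`.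
  have h3 : S n (fun i => inversion 0 1 (x i)) = (∏ i, (‖z₁ i‖ ^ 2) ^ Δ) * S n z₁ := by
    have hcfg : (fun i => (‖z₁ i‖ ^ 2)⁻¹ • (z₁ i - (2 * inner ℝ b (z₁ i)) • b)) =
        fun i => inversion 0 1 (x i) :=
      funext fun i => rinv_stage3_reflectInvert hb (x i) (z₁ i) rfl
    rw [← hcfg]
    exact hJ n b hb z₁ (fun i => (rinv_reflect_ne (hbx i).2).1)
      (fun i => (rinv_reflect_ne (hbx i).2).2)
  -- The weights: `‖z₁ i‖ = ‖x i‖`, `‖z₂ i‖² = ‖x i‖⁻²`, and the last two weights cancel.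
  have hn1 : ∀ i, ‖z₁ i‖ = ‖x i‖ := fun i => rinv_norm_reflect hb (x i)
  have hn2 : ∀ i, ‖z₂ i‖ ^ 2 = (‖x i‖ ^ 2)⁻¹ := fun i => rinv_stage2_norm_sq hw' (x i)
  have hw12 : (∏ i, (‖z₂ i‖ ^ 2) ^ Δ) * ∏ i, (‖-x i‖ ^ 2) ^ Δ = 1 := by
    rw [← Finset.prod_mul_distrib]
    refine Finset.prod_eq_one fun i _ => ?_
    rw [hn2, norm_neg, Real.inv_rpow (sq_nonneg _), inv_mul_cancel₀]
    exact (Real.rpow_pos_of_pos (pow_pos (norm_pos_iff.2 (hx0 i)) 2) Δ).ne'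
  rw [h3, h2, h1, ← mul_assoc, ← mul_assoc, mul_assoc (∏ i, (‖z₁ i‖ ^ 2) ^ Δ), hw12, mul_one]
  congr 1
  refine Finset.prod_congr rfl fun i _ => ?_
  rw [hn1, Real.rpow_mul (norm_nonneg _), Real.rpow_two]

end Summit.CriticalPhenomena.Ising3DConformalLimit.PrecisionLaplacianMoebiusLimitOfTwoPointLaw

end
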